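import Literature.NumberTheory.DiophantineApproximation.DiscrepancyNumericalIntegration
import Literature.NumberTheory.DiophantineApproximation.VandermondeDampener
import Literature.NumberTheory.Transcendental.LexExtremeCoefficient
import Mathlib.Analysis.SpecialFunctions.Complex.Log
import Mathlib.Tactic
import HarnessLib

/-!
# The torus supremum bound of CDT §6.5.3–6.5.4 (eqs. (6.23), (6.25)–(6.26))

Calegari–Dimitrov–Tang, arXiv:2408.15403, §6.5.3 (p. 53): for the auxiliary function
`F(𝐱) = Σ_{𝐢,𝐤} c_{𝐢,𝐤} 𝐱^𝐤 Π_s f_{i_s}(x_s)` of Lemma 61 (coefficients `|c_{𝐢,𝐤}| < e^{εdD}`,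
exponents `𝐤/D ∈ P_ε^d`) pulled back along `Φ = (φ_{k(1)},…,φ_{k(d)})`, "the triangle inequality
yields as a pointwise upper bound over `𝐳 ∈ 𝕋^d`:
`log|F(Φ(𝐳))| ≤ max_{𝐤/D ∈ P_ε^d ∩ ℤ^d} {Σ_j k_j log|Φ_j(z_j)|} + O(εα) + o(α)`" (eq. (6.23)); and
on the well-distributed part `T^d_{𝛄,ε}` of the torus the numerical integration estimate (6.24)
turns this into eqs. (6.25)–(6.26):
`sup_{T^d_{𝛄,ε}} log|F(Φ(𝐳))| ≤ (α/m) ∫₀¹ 2t·g*_{𝛗,𝛄}(t) dt + O(εα) + O(α/d) + o(α)`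
(`α/m = dD/2`).

We prove both for the product class of `Literature.Analysis.Fourier.TorusProductClass` /
`PullbackOnTorus` (`G(e(𝛉)) = Σ_{j∈S} c_j Π_t Φ_t(e(θ_t))^{k_{j,t}} u_{j,t}(e(θ_t))`, the
`u_{j,t} = h_t · (f_{i_t} ∘ Φ_t)` being bounded by `U` on the circle), with Lipschitz majorants
`ψ_k ≥ log|φ_k ∘ e|` in place of `log|φ_k ∘ e|` (an upper bound is all that is used):

* `norm_sum_prod_pow_mul_le` — eq. (6.23): `‖G‖ ≤ #S · C · U^d · exp(max_j Σ_t k_{j,t} ψ_t)`;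
* `norm_sum_prod_pow_mul_le_wellDistributed` — eqs. (6.25)–(6.26) in the symmetrised form of
  `Discrepancy.numericalIntegration`: for `𝛉 ∈ [0,1]^d` all of whose blocks have box discrepancy
  `≤ ε` and all exponents `𝐤_j/D` of box discrepancy `≤ ε`,
  `‖G(e(𝛉))‖ ≤ #S · C · U^d · exp((D/2)·[(1/d) Σ_{k,k'} d_k d_{k'} ∬ max(ψ_k,ψ_{k'})
     + εd(K+2S) + 2K(l+1) + S])`.

No named facts.

## References

* [CalegariDimitrovTang2024] F. Calegari, V. Dimitrov, Y. Tang, arXiv:2408.15403, §6.5.3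
  eq. (6.23) (p. 53), §6.5.4 eqs. (6.25)–(6.26) (p. 54).
-/

noncomputable section

open Finset Complex Literature.NumberTheory.DiophantineApproximation.Discrepancy

namespace Literature.NumberTheory.Transcendental

namespace CalegariDimitrovTang

variable {d : ℕ}

/-- `a^k ≤ exp(k ψ)` whenever `log a ≤ ψ` (`a ≥ 0`; for `a = 0 < k` the left side vanishes).
[folklore] -/
theorem pow_le_exp_mul_of_log_le {a ψ : ℝ} (ha : 0 ≤ a) (h : Real.log a ≤ ψ) (k : ℕ) :
    a ^ k ≤ Real.exp (k * ψ) := by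
  rcases eq_or_lt_of_le ha with rfl | hpos
  · rcases Nat.eq_zero_or_pos k with rfl | hk
    · simp
    · rw [zero_pow hk.ne']; exact (Real.exp_pos _).le
  · calc a ^ k = Real.exp (Real.log a) ^ k := by rw [Real.exp_log hpos]
      _ = Real.exp (k * Real.log a) := by rw [← Real.exp_nat_mul]
      _ ≤ Real.exp (k * ψ) := Real.exp_le_exp.mpr (mul_le_mul_of_nonneg_left h (Nat.cast_nonneg _))

/-- `Π_t ‖x_t‖^{k_t} ≤ exp(Σ_t k_t ψ_t)` for majorants `ψ_t ≥ log‖x_t‖`. [folklore] -/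
theorem prod_norm_pow_le_exp_sum (x : Fin d → ℂ) (k : Fin d → ℕ) (ψv : Fin d → ℝ)
    (hψ : ∀ t, Real.log ‖x t‖ ≤ ψv t) :
    ∏ t, ‖x t‖ ^ k t ≤ Real.exp (∑ t, (k t : ℝ) * ψv t) := by
  rw [Real.exp_sum]
  exact Finset.prod_le_prod (fun t _ => pow_nonneg (norm_nonneg _) _)
    fun t _ => pow_le_exp_mul_of_log_le (norm_nonneg _) (hψ t) (k t)

/-- **CDT eq. (6.23) (the triangle inequality for the pulled-back template).** For
`G = Σ_{j∈S} c_j Π_t x_t^{k_{j,t}} u_{j,t}` with `‖c_j‖ ≤ C`, `‖u_{j,t}‖ ≤ U` and majorants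
`log‖x_t‖ ≤ ψ_t` with `Σ_t k_{j,t} ψ_t ≤ A` for all `j ∈ S`:
`‖G‖ ≤ #S · C · U^d · e^A`. [cite: CalegariDimitrovTang2024, §6.5.3 eq. (6.23) (p. 53)] -/
theorem norm_sum_prod_pow_mul_le {ι : Type*} (S : Finset ι) (c : ι → ℂ) (k : ι → Fin d → ℕ)
    (x : Fin d → ℂ) (u : ι → Fin d → ℂ) {C U : ℝ} (hC : ∀ j ∈ S, ‖c j‖ ≤ C) (hU0 : 0 ≤ U)
    (hu : ∀ j ∈ S, ∀ t, ‖u j t‖ ≤ U) (ψv : Fin d → ℝ) (hψ : ∀ t, Real.log ‖x t‖ ≤ ψv t) {A : ℝ}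
    (hA : ∀ j ∈ S, ∑ t, (k j t : ℝ) * ψv t ≤ A) :
    ‖∑ j ∈ S, c j * ∏ t, (x t ^ k j t * u j t)‖ ≤ S.card * C * U ^ d * Real.exp A := by
  have hterm : ∀ j ∈ S, ‖c j * ∏ t, (x t ^ k j t * u j t)‖ ≤ C * U ^ d * Real.exp A := by
    intro j hj
    rw [norm_mul, norm_prod]
    have h1 : ∏ t, ‖x t ^ k j t * u j t‖ ≤ (∏ t, ‖x t‖ ^ k j t) * U ^ d := by
      have : ∏ t, ‖x t ^ k j t * u j t‖ = (∏ t, ‖x t‖ ^ k j t) * ∏ t, ‖u j t‖ := by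
        rw [← Finset.prod_mul_distrib]
        exact Finset.prod_congr rfl fun t _ => by rw [norm_mul, norm_pow]
      rw [this]
      refine mul_le_mul_of_nonneg_left ?_ (Finset.prod_nonneg fun t _ => pow_nonneg (norm_nonneg _) _)
      calc ∏ t, ‖u j t‖ ≤ ∏ _t : Fin d, U :=
            Finset.prod_le_prod (fun t _ => norm_nonneg _) fun t _ => hu j hj t
        _ = U ^ d := by rw [Finset.prod_const, card_univ, Fintype.card_fin]
    have h2 : ∏ t, ‖x t‖ ^ k j t ≤ Real.exp A :=
      (prod_norm_pow_le_exp_sum x (k j) ψv hψ).trans (Real.exp_le_exp.mpr (hA j hj))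
    have hC0 : 0 ≤ C := (norm_nonneg _).trans (hC j hj)
    calc ‖c j‖ * ∏ t, ‖x t ^ k j t * u j t‖ ≤ C * ((∏ t, ‖x t‖ ^ k j t) * U ^ d) :=
          mul_le_mul (hC j hj) h1 (Finset.prod_nonneg fun t _ => norm_nonneg _) hC0
      _ ≤ C * (Real.exp A * U ^ d) := by gcongr
      _ = C * U ^ d * Real.exp A := by ring
  calc ‖∑ j ∈ S, c j * ∏ t, (x t ^ k j t * u j t)‖ ≤ ∑ j ∈ S, ‖c j * ∏ t, (x t ^ k j t * u j t)‖ :=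
        norm_sum_le _ _
    _ ≤ ∑ _j ∈ S, C * U ^ d * Real.exp A := Finset.sum_le_sum hterm
    _ = S.card * C * U ^ d * Real.exp A := by rw [Finset.sum_const, nsmul_eq_mul]; ring

variable {l : ℕ}

/-- The right-hand side of the numerical integration estimate
(`Discrepancy.numericalIntegration`): `(1/d) Σ_{k,k'} d_k d_{k'} ∬ max(ψ_k, ψ_{k'})
+ εd(K+2S) + 2K(l+1) + S`. [cite: CalegariDimitrovTang2024, §6.5.4 eqs. (6.24)–(6.26)] -/
def niBound (blk : Fin d → Fin (l + 1)) (ψ : Fin (l + 1) → ℝ → ℝ) (K S ε : ℝ) : ℝ :=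
  (1 / d) * ∑ k, ∑ k', (blockCard blk k : ℝ) * blockCard blk k' * pairIntegral ψ k k'
    + ε * d * (K + 2 * S) + 2 * K * (l + 1) + S

/-- **CDT eqs. (6.25)–(6.26) (supremum over the well-distributed part of the torus),
symmetrised form.** Let `ψ_k` be `K`-Lipschitz majorants of `log|φ_k ∘ e|`, bounded by `S` on
`[0,1]`; let the template `G(e(𝛉)) = Σ_{j∈S} c_j Π_t φ_{k(t)}(e(θ_t))^{k_{j,t}} u_{j,t}(e(θ_t))`
(index set `J`) have `‖c_j‖ ≤ C`, `‖u_{j,t}(e(θ_t))‖ ≤ U`, exponents `k_{j,t} ≤ D` with `𝐤_j/D` of box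
discrepancy `≤ ε`; and let `𝛉 ∈ [0,1]^d` have all blocks `𝛉^{(k)}` of box discrepancy `≤ ε`.
Then `‖G(e(𝛉))‖ ≤ #J · C · U^d · exp((D/2) · niBound)`, i.e.
`log|F(Φ(𝐳))| ≤ (dD/2)·(1/d²)Σ_{k,k'} d_k d_{k'} ∬ max(ψ_k,ψ_{k'}) + O(εdD) + O(D) + log(#J·C·U^d)`.
[cite: CalegariDimitrovTang2024, §6.5.4 eqs. (6.25)–(6.26) (p. 54), via eq. (6.23)] -/
theorem norm_sum_prod_pow_mul_le_wellDistributed {ι : Type*} (blk : Fin d → Fin (l + 1))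
    (φ : Fin (l + 1) → ℂ → ℂ) (ψ : Fin (l + 1) → ℝ → ℝ) {K S ε : ℝ}
    (hK : ∀ k x y, |ψ k x - ψ k y| ≤ K * |x - y|) (hS : ∀ k, ∀ x ∈ Set.Icc (0 : ℝ) 1, |ψ k x| ≤ S)
    (e : ℝ → ℂ) (hψ : ∀ k θ, Real.log ‖φ k (e θ)‖ ≤ ψ k θ)
    {D : ℕ} (hD : 0 < D) (J : Finset ι) (c : ι → ℂ) (kof : ι → Fin d → ℕ)
    (hk1 : ∀ j ∈ J, ∀ t, kof j t ≤ D)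
    (hkD : ∀ j ∈ J, boxDiscrepancy (fun t => (kof j t : ℝ) / D) ≤ ε)
    (u : ι → Fin d → ℂ) {C U : ℝ} (hC : ∀ j ∈ J, ‖c j‖ ≤ C) (hU0 : 0 ≤ U)
    (hu : ∀ j ∈ J, ∀ t, ‖u j t‖ ≤ U)
    {θ : Fin d → ℝ} (hθ0 : ∀ j, 0 ≤ θ j) (hθ1 : ∀ j, θ j ≤ 1)
    (hθD : ∀ k, boxDiscrepancy (blockVec blk θ k) ≤ ε) :
    ‖∑ j ∈ J, c j * ∏ t, (φ (blk t) (e (θ t)) ^ kof j t * u j t)‖ ≤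
      J.card * C * U ^ d * Real.exp ((D : ℝ) / 2 * niBound blk ψ K S ε) := by
  refine norm_sum_prod_pow_mul_le J c kof (fun t => φ (blk t) (e (θ t))) u hC hU0 hu
    (fun t => ψ (blk t) (θ t)) (fun t => hψ _ _) fun j hj => ?_
  have hDr : (0 : ℝ) < D := by exact_mod_cast hD
  have hni := numericalIntegration blk ψ hK hS hθ0 hθ1 hθD
    (t := fun t => (kof j t : ℝ) / D) (fun t => by positivity)
    (fun t => by rw [div_le_one hDr]; exact_mod_cast hk1 j hj t) (hkD j hj)
  have hid : ∑ t, (kof j t : ℝ) * ψ (blk t) (θ t) =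
      (D : ℝ) / 2 * ∑ t, 2 * ((kof j t : ℝ) / D) * ψ (blk t) (θ t) := by
    rw [Finset.mul_sum]
    refine Finset.sum_congr rfl fun t _ => ?_
    field_simp
  rw [hid]
  exact mul_le_mul_of_nonneg_left hni (by positivity)

/-! ### The block Vandermondian as a polynomial dampener -/

/-- The same-block pairs `{(a,b) : a < b, k(a) = k(b)}`: `V_{S'} = Π_k V(𝐳^{(k)})` up to sign.
[cite: CalegariDimitrovTang2024, §6.5.2 eq. (6.18) (p. 52)] -/
def blockPairs (blk : Fin d → Fin (l + 1)) : Finset (Fin d × Fin d) :=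
  univ.filter fun p => p.1 < p.2 ∧ blk p.1 = blk p.2

/-- Pairs in `blockPairs` are increasing. [folklore] -/
theorem blockPairs_lt (blk : Fin d → Fin (l + 1)) : ∀ p ∈ blockPairs blk, p.1 < p.2 :=
  fun _ hp => (Finset.mem_filter.mp hp).2.1

/-- `Σ_k d_k = d` (in `ℕ`). [folklore] -/
theorem sum_blockCard_nat (blk : Fin d → Fin (l + 1)) : ∑ k, blockCard blk k = d := by
  have h := sum_blockCard blk
  exact_mod_cast h

/-- `e(θ) = exp(2πiθ)` in the two spellings used in the tree. [folklore] -/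
theorem unitPt_eq_exp (θ : ℝ) : unitPt θ = Complex.exp (2 * Real.pi * I * θ) := by
  unfold unitPt; congr 1; push_cast; ring

/-- `e` is `1`-periodic: `e(fract θ) = e(θ)`. [folklore] -/
theorem exp_fract (θ : ℝ) :
    Complex.exp (2 * Real.pi * I * (Int.fract θ : ℝ)) = Complex.exp (2 * Real.pi * I * θ) := by
  rw [← Int.self_sub_floor, Complex.ofReal_sub, mul_sub, Complex.exp_sub]
  have : Complex.exp (2 * Real.pi * I * ((⌊θ⌋ : ℝ) : ℂ)) = 1 := by
    have h := Complex.exp_int_mul_two_pi_mul_I ⌊θ⌋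
    rw [← h]; congr 1; push_cast; ring
  rw [this, div_one]

/-- **`|V_{S'}(𝐳)| = Π_k |V(𝐳^{(k)})|`** for the same-block pairs `S'`: the polynomial dampener of
`DampenedCoefficientBound` evaluates, in absolute value, to the block Vandermondian of
`VandermondeDampener`. [cite: CalegariDimitrovTang2024, §6.5.2 eq. (6.18) (p. 52)] -/
theorem norm_eval_vprod_blockPairs (blk : Fin d → Fin (l + 1)) (x : Fin d → ℂ) :
    ‖MvPolynomial.eval x (vprod (blockPairs blk) : MvPolynomial (Fin d) ℂ)‖ =
      ∏ k, vandermondeAbs (fun i => x (blockEmb blk k i)) := by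
  unfold vprod
  rw [map_prod, norm_prod]
  simp only [map_sub, MvPolynomial.eval_X]
  -- fiberwise over the block of the first coordinate
  rw [← Finset.prod_fiberwise (blockPairs blk) (fun p => blk p.1) fun p => ‖x p.1 - x p.2‖]
  refine Finset.prod_congr rfl fun k _ => ?_
  -- the block-`k` pairs are the images of the pairs `i < j` of `Fin d_k`
  unfold vandermondeAbs
  rw [← Finset.prod_finset_product' ((univ : Finset (Fin (blockCard blk k) × Fin (blockCard blk k))).filter
    fun q => q.1 < q.2) univ (fun i => Finset.Ioi i) (f := fun i j => ‖x (blockEmb blk k j) - x (blockEmb blk k i)‖)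
    (fun q => by simp)]
  symm
  refine Finset.prod_bij (fun q _ => (blockEmb blk k q.1, blockEmb blk k q.2)) ?_ ?_ ?_ ?_
  · intro q hq
    rw [Finset.mem_filter] at hq
    rw [Finset.mem_filter]
    refine ⟨?_, blk_blockEmb blk k q.1⟩
    unfold blockPairs
    rw [Finset.mem_filter]
    exact ⟨mem_univ _, (blockEmb blk k).lt_iff_lt.mpr hq.2, by rw [blk_blockEmb blk k q.1, blk_blockEmb blk k q.2]⟩
  · intro q₁ _ q₂ _ h
    simp only [Prod.mk.injEq] at h
    exact Prod.ext ((blockEmb blk k).injective h.1) ((blockEmb blk k).injective h.2)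
  · intro p hp
    rw [Finset.mem_filter] at hp
    obtain ⟨hp, hk⟩ := hp
    have hp' := Finset.mem_filter.mp hp
    have hrange : Set.range (blockEmb blk k) = (blockOf blk k : Set (Fin d)) :=
      Finset.range_orderEmbOfFin _ _
    have h1 : p.1 ∈ Set.range (blockEmb blk k) := by
      rw [hrange, Finset.mem_coe]; exact Finset.mem_filter.mpr ⟨mem_univ _, hk⟩
    have h2 : p.2 ∈ Set.range (blockEmb blk k) := by
      rw [hrange, Finset.mem_coe]; exact Finset.mem_filter.mpr ⟨mem_univ _, hp'.2.2 ▸ hk⟩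
    obtain ⟨i, hi⟩ := h1
    obtain ⟨j, hj⟩ := h2
    refine ⟨(i, j), ?_, ?_⟩
    · rw [Finset.mem_filter]
      refine ⟨mem_univ _, ?_⟩
      have := hp'.2.1
      rw [← hi, ← hj] at this
      exact (blockEmb blk k).lt_iff_lt.mp this
    · simp [hi, hj]
  · intro q _
    rw [norm_sub_rev]

/-- `|W(e(𝛉))| = dampener`: the `M`-th power of the polynomial dampener on the torus is the
dampener of `VandermondeDampener` in block form. [cite: CalegariDimitrovTang2024, §6.5.2
eq. (6.18)] -/
theorem norm_eval_vprod_pow_eq_dampener (blk : Fin d → Fin (l + 1)) (M : ℕ) (θ : Fin d → ℝ) :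
    ‖MvPolynomial.eval (fun s => Complex.exp (2 * Real.pi * I * θ s))
        ((vprod (blockPairs blk) : MvPolynomial (Fin d) ℂ) ^ M)‖ =
      dampener M (fun k (i : Fin (blockCard blk k)) => θ (blockEmb blk k i)) := by
  rw [map_pow, norm_pow, norm_eval_vprod_blockPairs, ← Finset.prod_pow]
  unfold dampener
  refine Finset.prod_congr rfl fun k _ => ?_
  congr 2
  funext i
  exact (unitPt_eq_exp _).symm

/-! ### The supremum of `|W · Φ^*F|` over the whole torus -/

/-- **CDT eqs. (6.26)–(6.28): the uniform bound for the dampened template on the torus.**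
Fix `ε > 0`, `λ > 0` and Lipschitz majorants `ψ_k ≥ log|φ_k ∘ e|` (`K`-Lipschitz, `|ψ_k| ≤ S` on
`[0,1]`). There is `d₁ = d₁(ε,λ)` such that for `d ≥ d₁`, any block assignment with all blocks
of size `≥ λd`, any `M ≥ 1`, `D ≥ 1`, and any template
`G = Σ_{j∈J} c_j Π_t φ_{k(t)}^{k_{j,t}} u_{j,t}` (`‖c_j‖ ≤ C`, `‖u_{j,t}‖ ≤ U` on the circle,
`k_{j,t} ≤ D`, `𝐤_j/D` of box discrepancy `≤ ε`), at every point of the torus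
`|W G| ≤ #J·C·U^d · max( d^{Md/2} e^{(D/2)·niBound}, e^{dDS − c'(ε,λ) M d²} )`
with `W = V_{S'}^M` the block Vandermondian dampener and `c'(ε,λ) = (π²ε³/192)λ²/2`: on the
well-distributed part `T_{𝛄,ε}` this is eq. (6.26) with `|W| ≤ d^{Md/2}` (eq. (6.20)), on the
complement eq. (6.19) gives `|W| ≤ e^{−c'Md²}` against the trivial `|G| ≤ #J C U^d e^{dDS}`
(eqs. (6.27)–(6.28)). [cite: CalegariDimitrovTang2024, §6.5.4–6.5.5 eqs. (6.26)–(6.28)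
(p. 54)] -/
theorem norm_dampened_template_le (φ : Fin (l + 1) → ℂ → ℂ) (ψ : Fin (l + 1) → ℝ → ℝ)
    {K S ε lam : ℝ} (hK : ∀ k x y, |ψ k x - ψ k y| ≤ K * |x - y|)
    (hS : ∀ k, ∀ x ∈ Set.Icc (0 : ℝ) 1, |ψ k x| ≤ S)
    (hψ : ∀ k (θ : ℝ), Real.log ‖φ k (Complex.exp (2 * Real.pi * I * θ))‖ ≤ ψ k θ)
    (hε : 0 < ε) (hlam : 0 < lam) :
    ∃ d₁ : ℕ, ∀ (d : ℕ), d₁ ≤ d → ∀ (blk : Fin d → Fin (l + 1)),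
      (∀ k, lam * d ≤ blockCard blk k) → ∀ (M : ℕ), 0 < M → ∀ (D : ℕ), 0 < D →
      ∀ {ι : Type} (J : Finset ι) (c : ι → ℂ) (kof : ι → Fin d → ℕ) (u : ι → Fin d → ℂ → ℂ)
        (C U : ℝ), (∀ j ∈ J, ‖c j‖ ≤ C) → 0 ≤ U →
        (∀ j ∈ J, ∀ t (θ : ℝ), ‖u j t (Complex.exp (2 * Real.pi * I * θ))‖ ≤ U) →
        (∀ j ∈ J, ∀ t, kof j t ≤ D) →
        (∀ j ∈ J, boxDiscrepancy (fun t => (kof j t : ℝ) / D) ≤ ε) →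
      ∀ θ : Fin d → ℝ,
        ‖MvPolynomial.eval (fun s => Complex.exp (2 * Real.pi * I * θ s))
            ((vprod (blockPairs blk) : MvPolynomial (Fin d) ℂ) ^ M) *
          ∑ j ∈ J, c j * ∏ t, (φ (blk t) (Complex.exp (2 * Real.pi * I * θ t)) ^ kof j t *
            u j t (Complex.exp (2 * Real.pi * I * θ t)))‖ ≤
        J.card * C * U ^ d *
          max ((d : ℝ) ^ ((M : ℝ) * d / 2) * Real.exp ((D : ℝ) / 2 * niBound blk ψ K S ε))
            (Real.exp (d * D * S - (Real.pi ^ 2 * ε ^ 3 / 192) * lam ^ 2 / 2 * M * (d : ℝ) ^ 2)) := by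
  obtain ⟨d₁, hd₁⟩ := dampener_le_exp_neg_uniform (l := l) hε hlam
  refine ⟨d₁, fun d hd blk hblk M hM D hD ι J c kof u C U hC hU0 hu hk1 hkD θ => ?_⟩
  have hS0 : 0 ≤ S := (abs_nonneg _).trans (hS 0 0 ⟨le_rfl, zero_le_one⟩)
  -- reduce to `θ ∈ [0,1)^d`
  set θ' : Fin d → ℝ := fun t => Int.fract (θ t) with hθ'
  have hθ'0 : ∀ t, 0 ≤ θ' t := fun t => Int.fract_nonneg _
  have hθ'1 : ∀ t, θ' t < 1 := fun t => Int.fract_lt_one _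
  have hexp : ∀ t, Complex.exp (2 * Real.pi * I * θ t) = Complex.exp (2 * Real.pi * I * θ' t) :=
    fun t => (exp_fract (θ t)).symm
  simp_rw [hexp]
  have hpt : (fun s => Complex.exp (2 * Real.pi * I * θ s)) = fun s => Complex.exp (2 * Real.pi * I * θ' s) :=
    funext hexp
  rw [norm_mul, norm_eval_vprod_pow_eq_dampener]
  -- the template bound common to both regimes
  have hJ0 : 0 ≤ (J.card : ℝ) * C * U ^ d := by
    rcases J.eq_empty_or_nonempty with hJ | ⟨j, hj⟩
    · simp [hJ]
    · exact mul_nonneg (mul_nonneg (Nat.cast_nonneg _) ((norm_nonneg _).trans (hC j hj))) (pow_nonneg hU0 _)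
  have hdamp0 := dampener_nonneg M (fun k (i : Fin (blockCard blk k)) => θ' (blockEmb blk k i))
  by_cases hgood : ∀ k, boxDiscrepancy (blockVec blk θ' k) ≤ ε
  · -- well-distributed part: `|W| ≤ d^{Md/2}` and eq. (6.26)
    have hW : dampener M (fun k (i : Fin (blockCard blk k)) => θ' (blockEmb blk k i)) ≤
        (d : ℝ) ^ ((M : ℝ) * d / 2) := dampener_le_rpow M _ (sum_blockCard_nat blk)
    have hG := norm_sum_prod_pow_mul_le_wellDistributed blk φ ψ hK hS
      (fun θ => Complex.exp (2 * Real.pi * I * θ)) hψ hD J c kof hk1 hkD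
      (fun j t => u j t (Complex.exp (2 * Real.pi * I * θ' t))) hC hU0 (fun j hj t => hu j hj t _)
      hθ'0 (fun t => (hθ'1 t).le) hgood
    calc dampener M (fun k (i : Fin (blockCard blk k)) => θ' (blockEmb blk k i)) *
          ‖∑ j ∈ J, c j * ∏ t, (φ (blk t) (Complex.exp (2 * Real.pi * I * θ' t)) ^ kof j t *
            u j t (Complex.exp (2 * Real.pi * I * θ' t)))‖
        ≤ (d : ℝ) ^ ((M : ℝ) * d / 2) *
            (J.card * C * U ^ d * Real.exp ((D : ℝ) / 2 * niBound blk ψ K S ε)) :=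
          mul_le_mul hW hG (norm_nonneg _) (by positivity)
      _ = J.card * C * U ^ d * ((d : ℝ) ^ ((M : ℝ) * d / 2) * Real.exp ((D : ℝ) / 2 * niBound blk ψ K S ε)) := by
          ring
      _ ≤ _ := mul_le_mul_of_nonneg_left (le_max_left _ _) hJ0
  · -- badly distributed part: eq. (6.19) against the trivial bound
    obtain ⟨k₀, hk₀⟩ := not_forall.mp hgood
    rw [not_le] at hk₀
    have hW : dampener M (fun k (i : Fin (blockCard blk k)) => θ' (blockEmb blk k i)) ≤
        Real.exp (-((Real.pi ^ 2 * ε ^ 3 / 192) * lam ^ 2 / 2) * M * (d : ℝ) ^ 2) :=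
      hd₁ d hd (fun k => blockCard blk k) M hM _ (fun k n => hθ'0 _) (fun k n => hθ'1 _)
        (sum_blockCard_nat blk) hblk k₀ hk₀.le
    have hG : ‖∑ j ∈ J, c j * ∏ t, (φ (blk t) (Complex.exp (2 * Real.pi * I * θ' t)) ^ kof j t *
        u j t (Complex.exp (2 * Real.pi * I * θ' t)))‖ ≤ J.card * C * U ^ d * Real.exp (d * D * S) := by
      refine norm_sum_prod_pow_mul_le J c kof (fun t => φ (blk t) (Complex.exp (2 * Real.pi * I * θ' t)))
        (fun j t => u j t (Complex.exp (2 * Real.pi * I * θ' t))) hC hU0 (fun j hj t => hu j hj t _)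
        (fun _ => S) (fun t => (hψ _ _).trans ((le_abs_self _).trans (hS _ _ ⟨hθ'0 t, (hθ'1 t).le⟩)))
        fun j hj => ?_
      calc ∑ t, (kof j t : ℝ) * S ≤ ∑ _t : Fin d, (D : ℝ) * S :=
            Finset.sum_le_sum fun t _ => mul_le_mul_of_nonneg_right (by exact_mod_cast hk1 j hj t) hS0
        _ = d * D * S := by rw [Finset.sum_const, card_univ, Fintype.card_fin, nsmul_eq_mul]; ring
    calc dampener M (fun k (i : Fin (blockCard blk k)) => θ' (blockEmb blk k i)) *
          ‖∑ j ∈ J, c j * ∏ t, (φ (blk t) (Complex.exp (2 * Real.pi * I * θ' t)) ^ kof j t *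
            u j t (Complex.exp (2 * Real.pi * I * θ' t)))‖
        ≤ Real.exp (-((Real.pi ^ 2 * ε ^ 3 / 192) * lam ^ 2 / 2) * M * (d : ℝ) ^ 2) *
            (J.card * C * U ^ d * Real.exp (d * D * S)) :=
          mul_le_mul hW hG (norm_nonneg _) (Real.exp_nonneg _)
      _ = J.card * C * U ^ d *
            Real.exp (d * D * S - (Real.pi ^ 2 * ε ^ 3 / 192) * lam ^ 2 / 2 * M * (d : ℝ) ^ 2) := by
          rw [sub_eq_add_neg, Real.exp_add]; ring_nf
      _ ≤ _ := mul_le_mul_of_nonneg_left (le_max_right _ _) hJ0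

end CalegariDimitrovTang

end Literature.NumberTheory.Transcendental
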